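import Literature.Probability.LatticeModels.PoissonDelaunayIsingScaling
import HarnessLib

/-!
# Translation invariance of the annealed Poisson–Delaunay correlators

Topic `Probability/LatticeModels`; theorem-only companion of `PoissonDelaunayIsingScaling.lean` (same
method: Mapping Theorem + Rényi uniqueness for the law, similarity-equivariance of the quenched
correlator off the null event of distance ties), for the crux `DeviceWeylUniversality` of route
`CriticalPhenomena/Ising3DConformalLimit/ConformalPoissonDevice` (stmt-CriticalPhenomena-4722, stub U':
the flat model `pdCorr (N • vol) β` is translation invariant, as its putative continuum limit must be).

* `pdCorr_add_const` — for a Haar measure `μ` and `t ≥ 0`,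
  `pdCorr (t • μ) β n (x + a) = pdCorr (t • μ) β n x`.

No definitions, no named facts.
-/

noncomputable section

open MeasureTheory Set Metric Function
open scoped NNReal ENNReal
open Literature.Analysis.FunctionSpaces

namespace Literature.Probability.LatticeModels

variable {E : Type*} [NormedAddCommGroup E] [NormedSpace ℝ E] [FiniteDimensional ℝ E]
  [MeasurableSpace E] [BorelSpace E] [Nontrivial E] (μ : Measure E) [μ.IsAddHaarMeasure]

/-- **Translation invariance of the annealed Poisson–Delaunay correlators**: for a Haar measure `μ`
and `t ≥ 0`, `pdCorr (t • μ) β n (x + a) = pdCorr (t • μ) β n x`. The translation `z ↦ z + a`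
preserves `t • μ` (Haar), hence the Poisson law (Mapping Theorem, Kingman 1993 §2.3, tree
`IsPoissonPointProcess.mapHomeomorph'`, and uniqueness `unique_holds`), and the quenched correlator is
isometry-equivariant off the null event of distance ties (`quenchedCorr_mapHomeomorph`,
`ae_injOn_dist_of_isPoissonPointProcess`). [cite: Kingman1993, §2.3 Mapping Theorem, p. 18] -/
theorem pdCorr_add_const (t : ℝ≥0) (a : E) (β : ℝ) {n : ℕ} (x : Fin n → E) :
    pdCorr (t • μ) β n (fun i => x i + a) = pdCorr (t • μ) β n x := by
  -- the translation by `a`, an isometry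
  set e : E ≃ₜ E := Homeomorph.addRight a with he_def
  have he_apply : ∀ z : E, e z = z + a := fun _ => rfl
  have he : ∀ y z : E, dist (e y) (e z) = 1 * dist y z := fun y z => by
    rw [he_apply, he_apply, one_mul, dist_add_right]
  -- the intensity and the Poisson law are translation invariant
  have hmapν : (t • μ).map e = t • μ := by
    rw [Measure.map_smul, show (⇑e : E → E) = (· + a) from funext he_apply, map_add_right_eq_self]
  have hP := isPoissonPointProcess_poissonLaw_smul_addHaar μ t
  have hPe : IsPoissonPointProcess (t • μ) ((poissonLaw (t • μ)).map (PointConfig.mapHomeomorph e)) := by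
    have := hP.mapHomeomorph' e
    rwa [hmapν] at this
  have hlaw : poissonLaw (t • μ) = (poissonLaw (t • μ)).map (PointConfig.mapHomeomorph e) :=
    IsPoissonPointProcess.unique_holds hP hPe
  -- transport the (possibly junk) Bochner integral along the measurable equivalence
  conv_lhs => rw [pdCorr_eq, hlaw, ← PointConfig.coe_mapHomeomorphEquiv, integral_map_equiv]
  rw [pdCorr_eq]
  refine integral_congr_ae ?_
  have hae : ∀ᵐ ω ∂(poissonLaw (t • μ)),
      ∀ i, Set.InjOn (fun p => dist (x i) p) ((ω : PointConfig E) : Set E) :=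
    ae_all_iff.2 fun i => ae_injOn_dist_of_isPoissonPointProcess μ t hP (x i)
  filter_upwards [hae] with ω hω
  rw [PointConfig.coe_mapHomeomorphEquiv]
  have hx : (fun i => e (x i)) = fun i => x i + a := funext fun i => he_apply (x i)
  rw [← hx]
  exact quenchedCorr_mapHomeomorph e one_pos he ω β x hω

end Literature.Probability.LatticeModels

end
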